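import Summits.QuantumFields.BalabanUV.T4Continuum.Support.ShellMeasureBlockWiringLandau
import Summits.QuantumFields.BalabanUV.T4Continuum.Support.ShellMeasureLandauHolonomyPrint

/-!
# `T4Continuum.ShellMeasureBlockWiringReadOuts` — S4 file 4: THE END OF RECORD'S READ-OUT LISTS ARE THE PLAQUETTES'
# FOUR ORIENTED BOND READ-OUTS
(cell `pub-balaban`, sub-cell `t4`, spine estimate NE7c (node U5b); NE7c ROUND-2 crew seat
`b2b-balaban-t4-ne7c-formalise-leaf-07` gen 3, row S4 «SM-L1 ∕ SM-L3 WIRING: packaging Bałaban's block geometry» of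
`t4/b2b-balaban-t4-ne7c-p1/LEAVES-NE7c-P1.md`; ADDITIVE — imports LD f5 `ShellMeasureBlockWiringLandau` (p211206; hence
S4 f1 `ShellMeasureBlockWiring`: `plaqOBonds`, `osgn`, `prod_map_plaqOBonds`) and the END of record LD f19
`ShellMeasureLandauHolonomyPrint` (p216023) ONLY; [folklore]; three DATA defs (`signedRO`, `signedReadOuts`,
`plaqReadOut` — objects, not propositions), 0 `def … : Prop`, 0 sorry, 0 citations)

HONEST FRAMING.  Finite four-torus programme, rung (B)+1 only — NOT infinite volume, NOT a mass gap, NOT the Clay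
problem, NOT summit progress; (B), `BetaPertHyp`, (B^μ) not consumed.  NE7c (`T4IndicatorShell.ShellWeightBound`) is
NOT PRINTED and NOT PROVED; «NE7c ⇐ the named binders» (trigger c3); (M1) realized ≠ NE7c.  BOOKKEEPING only: list
combinatorics over tree theorems BY NAME; no `def … : Prop` (c2); no read-out, exponent field or dictionary of
Bałaban's minimiser is instantiated; nothing printed is asserted (equation numbers LOCATE displayed shapes).

WHY.  The END of record for a live slot, `ShellMeasureLandauHolonomyPrint.slotAC_realized_su2_landauChart_print`
(WALL-NE7c-P1 §1), reads the classifier and the Wilson weight through READ-OUT LISTS `ℓs p`, `ℓw p` of continuous linear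
maps `𝒴 →L[ℂ] M_n(ℂ)` with norm constants `κr`, `κw`, length bounds `m`, `mw` and a read-out SET `L ∋ ℓw p` generating the
real structure `readOutReal L` — FOURTEEN free binders {`ℓs`, `κr`, `hκ`, `hℓ`, `m`, `hlen`, `ℓw`, `κw`, `hκw`, `hℓw`,
`mw`, `hlenw`, `L`, `hL`} of ARBITRARY list structure (WALL §2 (c) first clause, §2 (d)'s `L`).  On the lattice a
plaquette holonomy is the FOUR-letter word of the ORIENTED boundary bond variables (`Setup.GaugeField.plaqHol`; S4 f1
`plaqOBonds` ∕ `plaqHol_eq_prod_plaqOBonds`), each bond variable ONE read-out `ℓ b` of the exponent field (evaluation at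
`b` times `iη`; its constant `κ_b = L^{-j} ≤ 1` is print's DEFINITION of the norm, [Balaban1985Variational] (115)/(77) —
S18 (β); a binder here, not an estimate).  This file makes that structure a DEFINITION:
* §1 (generic bond index) `signedRO ℓ (b, o) = ±ℓ b` as a CLM (its value is S4 f1's `osgn o (ℓ b Y)`),
  `norm_signedRO_le`; the set `signedReadOuts ℓ` of all `±ℓ b`; **`mem_readOutReal_signedReadOuts`**:
  `Y ∈ readOutReal (signedReadOuts ℓ) ↔ ∀ b, ℓ b Y ∈ skewAdjoint A` («every bond value anti-Hermitian»).
* §2 (cell indexing) `plaqReadOut ℓ p := (plaqOBonds p).map (signedRO ℓ)`; `length_plaqReadOut` (`= 4`);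
  `norm_plaqReadOut_le` (from ONE per-bond bound); `plaqReadOut_mem_signedReadOuts`; **`holOf_plaqReadOut`**:
  `holOf (plaqReadOut ℓ p) Z y = exp (ℓ ⟨x,μ⟩ (Z y)) · exp (ℓ ⟨x+e_μ,ν⟩ (Z y)) · exp (−ℓ ⟨x+e_ν,μ⟩ (Z y)) · exp (−ℓ ⟨x,ν⟩ (Z y))`
  — LITERALLY the four-factor signed holonomy dictionary of S4 f1 `hAN_of_blockBondData` ∕ LD f5 `hAN_of_landauRays`;
  **`map_plaqHol_eq_holOf_plaqReadOut`**: for `U : GaugeField P j G` and a multiplicative `ρ : G →* A`, if the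
  represented boundary bond variables are the exponentials of the read-outs (`ρ (U b) = exp (ℓ b (Z y))`, (112)/(176)
  SHAPE) then `ρ (U(∂p)) = holOf (plaqReadOut ℓ p) Z y` — `Setup.GaugeField.plaqHol` (B7 (9)) MEETS the LD holonomy;
  whence `classifier_holOf_plaqReadOut_eq` (the LD classifier IS B14 (2.17)'s `max_{p ∈ P_u} ‖ρ (U(∂p)) − 1‖`) and
  `action_holOf_plaqReadOut_eq` (the LD sectioned action IS the Wilson action `β Σ_p (1 − τ(ρ U(∂p))/N) + 𝓔`);
  `hAN_of_landauRays_plaqReadOut` — LD f5 APPLIED with `hol := fun p => holOf (plaqReadOut ℓ p) Z` under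
  ray-consistency of the exponent field: the S4 and LD currencies of the classifier holonomy COINCIDE.
* §3 **`slotAC_realized_su2_landauChart_print_bondReadOuts`** — the END of record with the fourteen read-out binders
  GONE and {`ℓ`, `κ`, `hκ : 0 ≤ κ`, `hℓ : ∀ b Y, ‖ℓ b Y‖ ≤ κ‖Y‖`} ADDED (`P_u`, `P_w : Finset (Plaq P j)`,
  `ℓs = ℓw := plaqReadOut ℓ`, `L := signedReadOuts ℓ`, `m = mw = 4`); the weight-side smallness reads `4κz̄ ≤ 1` and (SM)
  `36·(e^{4κz̄} − 1)·1²/(r_Φ/S − 1)² ≤ δθ` — S4 f1 ∕ E2's `H = e^{4a} − 1` at `a = κz̄`.  ONE application of LD f19.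
WHAT STAYS DISPLAYED is unchanged otherwise (WALL §2): the scheme operators (a), the printed smallness (b), the per-term
pairs `Ef V i` of (c), the real structure's preservation (d), the numbers (e), the dictionary (f) — and the per-bond
constant `κ` itself (a binder `hℓ`).  NOTHING in the countdown moves.
HONEST DEPENDENCY: continuum YM on T⁴ ⇐ BetaPertH ∧ nine spine estimates (0/9 proved); BetaPertH ⇐ (D1) ∧ (D4) ∧ CAP+tail; G-an2-4 gates asym, D1 and NE2/3/4.
-/

noncomputable section

open Set Metric NormedSpace MeasureTheory Function

namespace Summit.QuantumFields.BalabanUV.T4Continuum.ShellMeasureBlockWiringReadOuts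

open scoped ENNReal
open Literature.MathematicalPhysics.QuantumFieldTheory.Balaban1983to89
open B11Prop6Scheme (Prop4Hyp)
open GaugeField (GaugeInvariant)
open T4ShellMeasure (SlotAntiConcentration)
open T4CubePoincare (cube)
open T4CubeChartGnomonic (SU2)
open T4CubeChartExp (expFibreChart)
open T4TreeGaugeFixing (NoClosedLoop fixTo)
open ShellMeasureWilsonWords (wordExp)
open ShellMeasureWilsonBlock (matrixTrace)
open ShellMeasureWilsonTrace (TraceData)
open ShellMeasureLevelAssembly (classifier action weight)
open ShellMeasureLandauHolonomy (solAt landauExp)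
open ShellMeasureLandauHolonomyChart (holOf holOf_apply cplx)
open ShellMeasureLandauHolonomySkew (readOutReal mem_readOutReal)
open ShellMeasureBlockWiring (osgn norm_osgn plaqOBonds length_plaqOBonds prod_map_plaqOBonds)
open ShellMeasureBlockWiringLandau (hAN_of_landauRays)
open ShellMeasureLandauHolonomyPrint (slotAC_realized_su2_landauChart_print)

/-! ## §1 Signed read-outs of oriented bonds (generic bond index) -/

section Generic

variable {𝒴 : Type*} [NormedAddCommGroup 𝒴] [NormedSpace ℂ 𝒴]
variable {A : Type*} [NormedRing A] [NormedAlgebra ℂ A]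
variable {𝔟 : Type*}

/-- **THE SIGNED READ-OUT OF AN ORIENTED BOND** `(b, o)`: the read-out `ℓ b` itself for a positively traversed bond
(`o = false`), its negative for a reversed one (`o = true`) — as a continuous linear map.  An object, not a
proposition. [folklore] -/
def signedRO (ℓ : 𝔟 → (𝒴 →L[ℂ] A)) (bo : 𝔟 × Bool) : 𝒴 →L[ℂ] A :=
  if bo.2 then -(ℓ bo.1) else ℓ bo.1

/-- the value of the signed read-out is S4 f1's signed letter `osgn o (ℓ b Y)`. [folklore] -/
theorem signedRO_apply (ℓ : 𝔟 → (𝒴 →L[ℂ] A)) (bo : 𝔟 × Bool) (Y : 𝒴) :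
    signedRO ℓ bo Y = osgn bo.2 (ℓ bo.1 Y) := by
  obtain ⟨b, o⟩ := bo
  cases o <;> simp [signedRO, osgn]

/-- positively traversed: `signedRO ℓ (b, false) = ℓ b`. [folklore] -/
@[simp] theorem signedRO_false (ℓ : 𝔟 → (𝒴 →L[ℂ] A)) (b : 𝔟) : signedRO ℓ (b, false) = ℓ b := by
  simp [signedRO]

/-- reversed: `signedRO ℓ (b, true) = −ℓ b`. [folklore] -/
@[simp] theorem signedRO_true (ℓ : 𝔟 → (𝒴 →L[ℂ] A)) (b : 𝔟) : signedRO ℓ (b, true) = -(ℓ b) := by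
  simp [signedRO]

/-- ONE per-bond bound gives the bound of every signed read-out: `‖±ℓ b Y‖ ≤ κ‖Y‖`. [folklore] -/
theorem norm_signedRO_le {ℓ : 𝔟 → (𝒴 →L[ℂ] A)} {κ : ℝ} (hℓ : ∀ b Y, ‖ℓ b Y‖ ≤ κ * ‖Y‖) (bo : 𝔟 × Bool)
    (Y : 𝒴) : ‖signedRO ℓ bo Y‖ ≤ κ * ‖Y‖ := by
  rw [signedRO_apply, norm_osgn]
  exact hℓ bo.1 Y

/-- **THE READ-OUT SET OF THE LATTICE**: all signed bond read-outs `±ℓ b`.  A set, not a proposition. [folklore] -/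
def signedReadOuts (ℓ : 𝔟 → (𝒴 →L[ℂ] A)) : Set (𝒴 →L[ℂ] A) :=
  range (signedRO ℓ)

/-- every signed read-out belongs to the read-out set. [folklore] -/
theorem signedRO_mem_signedReadOuts (ℓ : 𝔟 → (𝒴 →L[ℂ] A)) (bo : 𝔟 × Bool) :
    signedRO ℓ bo ∈ signedReadOuts ℓ :=
  mem_range_self bo

/-- the bare read-out belongs to the read-out set. [folklore] -/
theorem mem_signedReadOuts (ℓ : 𝔟 → (𝒴 →L[ℂ] A)) (b : 𝔟) : ℓ b ∈ signedReadOuts ℓ :=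
  ⟨(b, false), signedRO_false ℓ b⟩

/-- **THE REAL STRUCTURE GENERATED BY THE BOND READ-OUTS IS «EVERY BOND VALUE ANTI-HERMITIAN».**  For the read-out set
`signedReadOuts ℓ`, file (F)'s `readOutReal` — the configurations all of whose read-outs are skew-adjoint — is exactly
the set of `Y` with `ℓ b Y ∈ skewAdjoint A` for every bond `b` (the sign is immaterial: `skewAdjoint A` is a subgroup);
for `A = M_n(ℂ)` and `ℓ b` = evaluation at `b`, the 𝔲(n)-valued configurations ([Balaban1985Variational] (115)/(176)
TYPE). [folklore] -/
theorem mem_readOutReal_signedReadOuts [StarAddMonoid A] (ℓ : 𝔟 → (𝒴 →L[ℂ] A)) (Y : 𝒴) :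
    Y ∈ readOutReal (signedReadOuts ℓ) ↔ ∀ b, ℓ b Y ∈ skewAdjoint A := by
  rw [mem_readOutReal]
  constructor
  · exact fun h b => h (ℓ b) (mem_signedReadOuts ℓ b)
  · rintro h ℓ' ⟨⟨b, o⟩, rfl⟩
    cases o
    · simpa only [signedRO_false] using h b
    · simpa only [signedRO_true, neg_apply] using (skewAdjoint A).neg_mem (h b)

end Generic

/-! ## §2 The cell's indexing: the read-out list of a plaquette; its holonomy is the four-factor signed word -/

section Cell

variable {P : Params} {j : ℕ}
variable {𝒴 : Type*} [NormedAddCommGroup 𝒴] [NormedSpace ℂ 𝒴]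
variable {A : Type*} [NormedRing A] [NormedAlgebra ℂ A]

/-- **THE READ-OUT LIST OF A PLAQUETTE**: the signed read-outs of its four oriented boundary bonds, in the order and
with the inversions of `Setup.GaugeField.plaqHol` (S4 f1 `plaqOBonds`: `(⟨x,μ⟩,+)`, `(⟨x+e_μ,ν⟩,+)`, `(⟨x+e_ν,μ⟩,−)`,
`(⟨x,ν⟩,−)`).  A list, not a proposition. [folklore] -/
def plaqReadOut (ℓ : PBond P j → (𝒴 →L[ℂ] A)) (p : Plaq P j) : List (𝒴 →L[ℂ] A) :=
  (plaqOBonds p).map (signedRO ℓ)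

/-- four letters. [folklore] -/
@[simp] theorem length_plaqReadOut (ℓ : PBond P j → (𝒴 →L[ℂ] A)) (p : Plaq P j) :
    (plaqReadOut ℓ p).length = 4 := by
  simp [plaqReadOut]

/-- the END's length binder `hlen`/`hlenw` with `m = 4`, for any plaquette family. [folklore] -/
theorem length_plaqReadOut_le (Pu : Finset (Plaq P j)) (ℓ : PBond P j → (𝒴 →L[ℂ] A)) :
    ∀ p ∈ Pu, (plaqReadOut ℓ p).length ≤ 4 :=
  fun p _ => (length_plaqReadOut ℓ p).le

/-- the END's norm binder `hℓ`/`hℓw` from ONE per-bond bound: every letter of every plaquette's read-out list has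
`‖ℓ' Y‖ ≤ κ‖Y‖`. [folklore] -/
theorem norm_plaqReadOut_le {ℓ : PBond P j → (𝒴 →L[ℂ] A)} {κ : ℝ} (hℓ : ∀ b Y, ‖ℓ b Y‖ ≤ κ * ‖Y‖)
    (Pu : Finset (Plaq P j)) : ∀ p ∈ Pu, ∀ ℓ' ∈ plaqReadOut ℓ p, ∀ Y, ‖ℓ' Y‖ ≤ κ * ‖Y‖ := by
  intro p _ ℓ' hℓ' Y
  obtain ⟨bo, -, rfl⟩ := List.mem_map.1 hℓ'
  exact norm_signedRO_le hℓ bo Y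

/-- the END's membership binder `hL`: every letter of every plaquette's read-out list lies in the read-out set
`signedReadOuts ℓ`. [folklore] -/
theorem plaqReadOut_mem_signedReadOuts (ℓ : PBond P j → (𝒴 →L[ℂ] A)) (Pw : Finset (Plaq P j)) :
    ∀ p ∈ Pw, ∀ ℓ' ∈ plaqReadOut ℓ p, ℓ' ∈ signedReadOuts ℓ := by
  intro p _ ℓ' hℓ'
  obtain ⟨bo, -, rfl⟩ := List.mem_map.1 hℓ'
  exact signedRO_mem_signedReadOuts ℓ bo

/-- **THE HOLONOMY OF THE READ-OUT LIST IS THE FOUR-FACTOR SIGNED WORD.**  For any exponent field `Z : E → 𝒴`, the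
LD holonomy `holOf (plaqReadOut ℓ p) Z` (`ShellMeasureLandauHolonomyChart.holOf`: the word of exponentials of the
read-outs of `Z y`) is, at every chart point, `exp (ℓ ⟨x,μ⟩ (Z y)) · exp (ℓ ⟨x+e_μ,ν⟩ (Z y)) · exp (−ℓ ⟨x+e_ν,μ⟩ (Z y)) ·
exp (−ℓ ⟨x,ν⟩ (Z y))` — token for token the holonomy dictionary of S4 f1 `hAN_of_blockBondData` ∕ LD f5
`hAN_of_landauRays` with the bond variables `X b = ℓ b (Z y)`. [folklore] -/
theorem holOf_plaqReadOut {E : Type*} (ℓ : PBond P j → (𝒴 →L[ℂ] A)) (p : Plaq P j) (Z : E → 𝒴) (y : E) :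
    holOf (plaqReadOut ℓ p) Z y =
      exp (ℓ ⟨p.src, p.μ⟩ (Z y)) * exp (ℓ ⟨p.src.shift p.μ, p.ν⟩ (Z y)) *
        exp (-(ℓ ⟨p.src.shift p.ν, p.μ⟩ (Z y))) * exp (-(ℓ ⟨p.src, p.ν⟩ (Z y))) := by
  rw [holOf_apply, wordExp, plaqReadOut, List.map_map, List.map_map]
  rw [show ((exp ∘ fun ℓ' : 𝒴 →L[ℂ] A => ℓ' (Z y)) ∘ signedRO ℓ) =
      fun bo : PBond P j × Bool => exp (signedRO ℓ bo (Z y)) from rfl]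
  rw [prod_map_plaqOBonds]
  simp only [signedRO_false, signedRO_true, neg_apply]

/-- in a complete normed algebra, `ρ g = exp X` for a group element `g` forces `ρ g⁻¹ = exp (−X)` (both are the
inverse of `exp X`). [folklore] -/
theorem map_inv_eq_exp_neg [CompleteSpace A] {G : Type*} [Group G] (ρ : G →* A) {g : G} {X : A}
    (h : ρ g = exp X) : ρ g⁻¹ = exp (-X) := by
  letI : NormedAlgebra ℚ A := NormedAlgebra.restrictScalars ℚ ℂ A
  have h1 : ρ g⁻¹ * ρ g = 1 := by rw [← map_mul, inv_mul_cancel, map_one]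
  have h2 : exp X * exp (-X) = 1 := by
    rw [← exp_add_of_commute (Commute.refl X).neg_right, add_neg_cancel, exp_zero]
  calc ρ g⁻¹ = ρ g⁻¹ * (exp X * exp (-X)) := by rw [h2, mul_one]
    _ = ρ g⁻¹ * ρ g * exp (-X) := by rw [h, mul_assoc]
    _ = exp (-X) := by rw [h1, one_mul]

/-- **THE LD HOLONOMY IS THE IMAGE OF THE LATTICE PLAQUETTE VARIABLE.**  For a configuration `U : GaugeField P j G`
and a multiplicative representation `ρ : G →* A` (e.g. the inclusion `SU(2) ↪ M₂(ℂ)`): if on the four boundary bonds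
of `p` the represented bond variables are the exponentials of the read-outs of the exponent `Z y`,
`ρ (U b) = exp (ℓ b (Z y))` ([Balaban1985Variational] (112)/(176) SHAPE `U = exp(iη𝓗)`, read per bond), then
`ρ (U(∂p)) = holOf (plaqReadOut ℓ p) Z y` — `Setup.GaugeField.plaqHol` (B7 (9)) meets
`ShellMeasureLandauHolonomyChart.holOf`; the reversed bonds contribute `exp (−ℓ b (Z y)) = ρ (U b)⁻¹`
(`map_inv_eq_exp_neg`). [folklore] -/
theorem map_plaqHol_eq_holOf_plaqReadOut [CompleteSpace A] {G : Type*} [GaugeGroup G] (ρ : G →* A)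
    (U : GaugeField P j G) (p : Plaq P j) {E : Type*} (ℓ : PBond P j → (𝒴 →L[ℂ] A)) (Z : E → 𝒴) (y : E)
    (hU : ∀ bo ∈ plaqOBonds p, ρ (U bo.1) = exp (ℓ bo.1 (Z y))) :
    ρ (GaugeField.plaqHol U p) = holOf (plaqReadOut ℓ p) Z y := by
  have h1 := hU (⟨p.src, p.μ⟩, false) (by simp [plaqOBonds])
  have h2 := hU (⟨p.src.shift p.μ, p.ν⟩, false) (by simp [plaqOBonds])
  have h3 := hU (⟨p.src.shift p.ν, p.μ⟩, true) (by simp [plaqOBonds])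
  have h4 := hU (⟨p.src, p.ν⟩, true) (by simp [plaqOBonds])
  rw [holOf_plaqReadOut, GaugeField.plaqHol, map_mul, map_mul, map_mul, h1, h2, map_inv_eq_exp_neg ρ h3,
    map_inv_eq_exp_neg ρ h4]

/-- **HENCE THE LD CLASSIFIER IS B14 (2.17)'s `max_p |U(∂p) − 1|`, REPRESENTED.**  Under the same per-bond
identification on the boundary bonds of every classifier plaquette, `classifier hPu (fun p => holOf (plaqReadOut ℓ p) Z) y
= max_{p ∈ P_u} ‖ρ (U(∂p)) − 1‖` (`ShellMeasureLevelAssembly.classifier`). [folklore] -/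
theorem classifier_holOf_plaqReadOut_eq [CompleteSpace A] [NormOneClass A] {G : Type*} [GaugeGroup G] (ρ : G →* A)
    (U : GaugeField P j G) {Pu : Finset (Plaq P j)} (hPu : Pu.Nonempty) {E : Type*}
    (ℓ : PBond P j → (𝒴 →L[ℂ] A)) (Z : E → 𝒴) (y : E)
    (hU : ∀ p ∈ Pu, ∀ bo ∈ plaqOBonds p, ρ (U bo.1) = exp (ℓ bo.1 (Z y))) :
    classifier hPu (fun p => holOf (plaqReadOut ℓ p) Z) y = Pu.sup' hPu fun p => ‖ρ (GaugeField.plaqHol U p) - 1‖ := by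
  unfold classifier
  exact Finset.sup'_congr hPu rfl fun p hp => by rw [map_plaqHol_eq_holOf_plaqReadOut ρ U p ℓ Z y (hU p hp)]

/-- **AND THE LD WILSON WEIGHT IS THE LATTICE WILSON WEIGHT, REPRESENTED.**  Under the per-bond identification on the
boundary bonds of every weight plaquette, the sectioned action of `ShellMeasureLevelAssembly` read through the
plaquette read-outs is `β Σ_{p ∈ P_w} (1 − τ(ρ (U(∂p)))/N) + 𝓔 y` (B12 (0.2)'s Wilson action of the configuration `U`,
in the trace datum `T`), hence so is the `weight = e^{−action}` of the dictionary `hRdict`. [folklore] -/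
theorem action_holOf_plaqReadOut_eq [CompleteSpace A] {G : Type*} [GaugeGroup G] (ρ : G →* A)
    (U : GaugeField P j G) (T : TraceData A) (β : ℝ) (Pw : Finset (Plaq P j)) {E : Type*}
    (ℓ : PBond P j → (𝒴 →L[ℂ] A)) (Z : E → 𝒴) (𝓔 : E → ℝ) (y : E)
    (hU : ∀ p ∈ Pw, ∀ bo ∈ plaqOBonds p, ρ (U bo.1) = exp (ℓ bo.1 (Z y))) :
    action T β Pw (fun p => holOf (plaqReadOut ℓ p) Z) 𝓔 y =
      β * ∑ p ∈ Pw, (1 - T.τ (ρ (GaugeField.plaqHol U p)) / T.N) + 𝓔 y := by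
  unfold action
  congr 2
  exact Finset.sum_congr rfl fun p hp => by rw [map_plaqHol_eq_holOf_plaqReadOut ρ U p ℓ Z y (hU p hp)]

variable [CompleteSpace A]

/-- **LD f5 APPLIED WITH THE DEFINED HOLONOMY.**  `ShellMeasureBlockWiringLandau.hAN_of_landauRays` (E2's `hAN` from
the Landau read-out data `Y`, `Dc`, `H` along the rays) with `hol := fun p => holOf (plaqReadOut ℓ p) Z`: its holonomy
dictionary `hhol` is DISCHARGED by `holOf_plaqReadOut` once the exponent field is RAY-CONSISTENT with the Landau data,
`Z (c • x) = Y x c − H (Dc x c)` on `0 ≤ c ≤ 1` (the one displayed identification left).  The S4 currency and the LD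
currency of the classifier holonomy coincide. [folklore] -/
theorem hAN_of_landauRays_plaqReadOut {E : Type*} [AddCommGroup E] [Module ℝ E]
    {𝒳 : Type*} [NormedAddCommGroup 𝒳] [NormedSpace ℂ 𝒳]
    {W : Set E} {Pu : Finset (Plaq P j)} {Λu : Finset (PBond P j)}
    (hcov : ∀ p ∈ Pu, ∀ bo ∈ plaqOBonds p, bo.1 ∈ Λu)
    (H : 𝒳 →L[ℂ] 𝒴) {B₀ : ℝ} (hB₀ : 0 ≤ B₀) (hH : ∀ X, ‖H X‖ ≤ B₀ * ‖X‖)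
    {C₂ ε Rad κ : ℝ} (Y : E → ℂ → 𝒴) (Dc : E → ℂ → 𝒳)
    (hYd : ∀ x ∈ W, DifferentiableOn ℂ (Y x) (ball 0 Rad)) (hY : ∀ x ∈ W, ∀ σ ∈ ball (0 : ℂ) Rad, ‖Y x σ‖ < ε)
    (hY0 : ∀ x ∈ W, Y x 0 = 0) (hDd : ∀ x ∈ W, DifferentiableOn ℂ (Dc x) (ball 0 Rad))
    (hDb : ∀ x ∈ W, ∀ σ ∈ ball (0 : ℂ) Rad, ‖Dc x σ‖ ≤ 4 * C₂ * ε ^ 2) (hD0 : ∀ x ∈ W, Dc x 0 = 0)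
    (ℓ : PBond P j → (𝒴 →L[ℂ] A)) (hκ : 0 ≤ κ) (hℓ : ∀ b ∈ Λu, ∀ Z, ‖ℓ b Z‖ ≤ κ * ‖Z‖)
    (Z : E → 𝒴) (hZ : ∀ x ∈ W, ∀ c : ℝ, 0 ≤ c → c ≤ 1 → Z (c • x) = Y x c - H (Dc x c)) :
    ∀ x ∈ W, ∀ p ∈ Pu, ∃ f : ℂ → A, DifferentiableOn ℂ f (ball 0 Rad) ∧
      (∀ w ∈ ball (0 : ℂ) Rad, ‖f w‖ ≤ Real.exp (4 * (κ * (ε + B₀ * (4 * C₂ * ε ^ 2)))) - 1) ∧ f 0 = 0 ∧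
      ∀ c : ℝ, 0 ≤ c → c ≤ 1 → f (c : ℂ) = holOf (plaqReadOut ℓ p) Z (c • x) - 1 :=
  hAN_of_landauRays hcov (fun p => holOf (plaqReadOut ℓ p) Z) H hB₀ hH Y Dc hYd hY hY0 hDd hDb hD0 ℓ hκ hℓ
    fun x hx p _ c hc0 hc1 => by rw [holOf_plaqReadOut, hZ x hx c hc0 hc1]

end Cell

/-! ## §3 The END of record read through the bond read-outs -/

section EndBondReadOuts

open scoped Matrix.Norms.L2Operator

variable {P : Params} {j : ℕ} [DecidableEq (PBond P j)]
variable {n : Type*} [Fintype n] [DecidableEq n] [Nonempty n]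
variable {𝒴 𝒴' 𝒳 𝒵 ℬ : Type*} [NormedAddCommGroup 𝒴] [NormedSpace ℂ 𝒴] [CompleteSpace 𝒴]
  [NormedAddCommGroup 𝒴'] [NormedSpace ℂ 𝒴'] [NormedAddCommGroup 𝒳] [NormedSpace ℂ 𝒳] [CompleteSpace 𝒳]
  [NormedAddCommGroup 𝒵] [NormedSpace ℂ 𝒵] [NormedAddCommGroup ℬ] [NormedSpace ℂ ℬ]

/-- **REALIZED (M1) PER SLOT (`G = SU(2)`) — THE END OF RECORD READ THROUGH THE BOND READ-OUTS.**  LD f19's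
`slotAC_realized_su2_landauChart_print` with its fourteen read-out binders {`ℓs`, `κr`, `hκ`, `hℓ`, `m`, `hlen`, `ℓw`,
`κw`, `hκw`, `hℓw`, `mw`, `hlenw`, `L`, `hL`} GONE; in their place ONE bond read-out family
`ℓ : PBond P j → (𝒴 →L[ℂ] M_n(ℂ))` with ONE per-bond constant, `‖ℓ b Y‖ ≤ κ‖Y‖` (print's DEFINITION of the norm,
[Balaban1985Variational] (115)/(77), `κ_b = L^{-j} ≤ 1` — S18 (β); a binder, not an estimate).  The classifier
plaquettes `P_u` and the weight plaquettes `P_w` are plaquettes of the lattice; both are read through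
`plaqReadOut ℓ p` (§2), the real structure is `readOutReal (signedReadOuts ℓ)` («every bond value anti-Hermitian»,
§1), `m = m_w = 4`.  Every other binder VERBATIM from LD f19 ((a) scheme operators, (b) printed smallness, (c) per-term
pairs, (d) preservation of the real structure, (e) numbers, (f) dictionary ∕ support ∕ co-tests), with the weight-side
smallness `4κz̄ ≤ 1` and (SM) `36·(e^{4κz̄} − 1)·1²/(r_Φ/S − 1)² ≤ δθ` — S4 f1 ∕ E2's `H = e^{4a} − 1` at `a = κz̄`,
`z̄ = (ε₄ + B₀·2dLC₁ε₁) + B₀·4C₂(ε₄ + B₀·2dLC₁ε₁)²`.  CONCLUSION: E2′'s, literally, with the constant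
`2(m₀ + β Σ_{p ∈ P_w} (4·(3κz̄/(r_Φ/S − 1)))·(0 + 4·(4κz̄)) + 3H̄/(r_Φ/S − 1))/(1 − δ)`.  ONE application of LD f19.
A junction; CONDITIONAL on every binder; nothing PRINTED is asserted; NOT Bałaban's minimiser or effective action;
NE7c NOT PROVED. [folklore] -/
theorem slotAC_realized_su2_landauChart_print_bondReadOuts {T : Finset (PBond P j)} (hT : NoClosedLoop T)
    (U₀ : GaugeField P j SU2) (Λ : Finset (PBond P j)) {m₀ : ℕ} (e : ↥Λ × Fin 3 ≃ Fin m₀)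
    {S : ℝ} (hS : 0 < S) (hSπ : 3 * S ^ 2 < Real.pi ^ 2) (c : GaugeField P j SU2 → GaugeField P j SU2)
    {F : GaugeField P j SU2 → ℝ≥0∞} (hF : Measurable F) (hFi : GaugeInvariant F)
    -- print's (1.27) window as a SUPPORT property of the `T`-gauged sections (S20)
    (hFsupp : ∀ V y, F (fixTo T U₀ (updateFinset V Λ y)) ≠ 0 →
      ∀ b (hb : b ∈ Λ), dist1 ((c V b)⁻¹ * y ⟨b, hb⟩) ≤ 2 * Real.sin (S / 2))
    {u : GaugeField P j SU2 → ℝ} (hu : Measurable u) (hui : GaugeInvariant u)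
    -- classifier plaquettes and weight plaquettes OF THE LATTICE, window, co-test
    {Pu : Finset (Plaq P j)} (hPu : Pu.Nonempty) (Pw : Finset (Plaq P j))
    (W : GaugeField P j SU2 → Set (Fin m₀ → ℝ)) (Jco : GaugeField P j SU2 → (Fin m₀ → ℝ) → ℝ≥0∞)
    {θ δ ρ β : ℝ}
    -- THE SCHEME OPERATORS per exterior section with V-uniform constants ((P2), (P4), (103), (75), (44), scaling, (46))
    (𝒢 : GaugeField P j SU2 → (𝒵 →L[ℂ] 𝒴)) (W𝒱 : GaugeField P j SU2 → 𝒴 → 𝒵) {B₀ C₄ a₃ ε₄ : ℝ}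
    (h𝒢 : ∀ V f, ‖𝒢 V f‖ ≤ B₀ * ‖f‖) (hW : ∀ V, Prop4Hyp (W𝒱 V) C₄ a₃) (hB₀ : 0 < B₀) (hC₄ : 0 ≤ C₄)
    (hε₄ : 0 ≤ ε₄)
    -- Prop. 6's PRINTED smallness (p. 295) with `dL ≤ B₃`; the coarse-field size `2dLC₁ε₁` of (75)
    {dL C₁ B₃ ε₁ : ℝ} (hdL : 0 ≤ dL) (hC₁ : 0 ≤ C₁) (hε₁ : 0 ≤ ε₁) (hB₃ : dL ≤ B₃)
    (h1 : 2 * B₀ * C₁ * B₃ * ε₁ ≤ ε₄) (h2 : 4 * ε₄ ≤ a₃) (h3 : 16 * B₀ * C₄ * ε₄ ≤ 1)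
    (H₁ : GaugeField P j SU2 → (ℬ →L[ℂ] 𝒴)) (hH₁ : ∀ V B, ‖H₁ V B‖ ≤ B₀ * ‖B‖)
    (Φ : GaugeField P j SU2 → (Fin m₀ → ℂ) → ℬ) {rΦ : ℝ} (hΦd : ∀ V, DifferentiableOn ℂ (Φ V) (ball 0 rΦ))
    (hΦ0 : ∀ V, Φ V 0 = 0) (hΦ : ∀ V, ∀ z ∈ ball (0 : Fin m₀ → ℂ) rΦ, ‖Φ V z‖ < 2 * dL * C₁ * ε₁) (hSr : S < rΦ)
    (Cf : GaugeField P j SU2 → 𝒴' → 𝒳) {C₂ RC : ℝ} (hC₂ : 0 ≤ C₂)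
    (hCq : ∀ V, ∀ Z : 𝒴', ‖Z‖ < RC → ‖Cf V Z‖ ≤ C₂ * ‖Z‖ ^ 2) (hCd : ∀ V, DifferentiableOn ℂ (Cf V) (ball 0 RC))
    (ιs : GaugeField P j SU2 → (𝒴 →L[ℂ] 𝒴')) (hι : ∀ V Y, ‖ιs V Y‖ ≤ ‖Y‖)
    (Hop : GaugeField P j SU2 → (𝒳 →L[ℂ] 𝒴)) (hH : ∀ V X, ‖Hop V X‖ ≤ B₀ * ‖X‖)
    -- Prop. 3's PRINTED smallness (p. 286) + the located coupling into its domain and B13's domain condition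
    {ε₃ : ℝ} (h18 : 18 * C₂ * B₀ * ε₃ ≤ 1) (hcoup : ε₄ + B₀ * (2 * dL * C₁ * ε₁) ≤ ε₃) (h3R : 3 * ε₃ ≤ RC)
    -- THE BOND READ-OUTS: ONE family, ONE per-bond constant ((115)/(77): `κ_b = L^{-j} ≤ 1`, a DEFINITION in print)
    (ℓ : PBond P j → (𝒴 →L[ℂ] Matrix n n ℂ)) {κ : ℝ} (hκ : 0 ≤ κ) (hℓ : ∀ b Y, ‖ℓ b Y‖ ≤ κ * ‖Y‖)
    -- the per-term functionals of the non-Wilson terms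
    {𝔱 : Type*} (I : Finset 𝔱) (Ef : GaugeField P j SU2 → 𝔱 → 𝒴 → ℂ) {rE : ℝ} {eb : 𝔱 → ℝ} {Hbar : ℝ}
    (hEd : ∀ V, ∀ i ∈ I, DifferentiableOn ℂ (Ef V i) (ball 0 rE))
    (hEb : ∀ V, ∀ i ∈ I, ∀ Z ∈ ball (0 : 𝒴) rE, ‖Ef V i Z‖ ≤ eb i) (hsum : ∑ i ∈ I, 2 * eb i ≤ Hbar)
    (hcoupE : (ε₄ + B₀ * (2 * dL * C₁ * ε₁)) + B₀ * (4 * C₂ * (ε₄ + B₀ * (2 * dL * C₁ * ε₁)) ^ 2) ≤ rE)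
    -- THE REAL STRUCTURE: the configurations with anti-Hermitian bond read-outs; its images; preservation
    (𝓡𝒵 : AddSubgroup 𝒵) (𝓡𝒴' : AddSubgroup 𝒴') (𝓡𝒳 : AddSubgroup 𝒳) (h𝓡𝒳 : IsClosed (𝓡𝒳 : Set 𝒳))
    (𝓡ℬ : AddSubgroup ℬ)
    (h𝒢r : ∀ V, ∀ f ∈ 𝓡𝒵, 𝒢 V f ∈ readOutReal (signedReadOuts ℓ))
    (hWr : ∀ V, ∀ Y ∈ readOutReal (signedReadOuts ℓ), W𝒱 V Y ∈ 𝓡𝒵)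
    (hιr : ∀ V, ∀ Y ∈ readOutReal (signedReadOuts ℓ), ιs V Y ∈ 𝓡𝒴')
    (hHr : ∀ V, ∀ X ∈ 𝓡𝒳, Hop V X ∈ readOutReal (signedReadOuts ℓ))
    (hCr : ∀ V, ∀ Z ∈ 𝓡𝒴', Cf V Z ∈ 𝓡𝒳) (hH₁r : ∀ V, ∀ B ∈ 𝓡ℬ, H₁ V B ∈ readOutReal (signedReadOuts ℓ))
    (hΦr : ∀ V, ∀ y : Fin m₀ → ℝ, ‖y‖ ≤ S → Φ V (cplx y) ∈ 𝓡ℬ)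
    -- DICTIONARY (on the chart cube only): the density's OWN sections with the weight words of the PLAQUETTE READ-OUTS
    -- and the non-Wilson term; the tested variable with the classifier holonomies of the PLAQUETTE READ-OUTS — of the
    -- SAME exponent field (`holOf_plaqReadOut`: each holonomy is the four-factor signed word of the bond read-outs)
    (hRdict : ∀ V, ∀ x ∈ cube m₀ S,
      F (fixTo T U₀ (updateFinset V Λ (expFibreChart Λ (c V) e x))) = Jco V x * weight (matrixTrace (n := n)) β Pw
        (fun p => holOf (plaqReadOut ℓ p) (fun y => landauExp (Cf V) (ιs V) (Hop V)
          (4 * C₂ * (ε₄ + B₀ * (2 * dL * C₁ * ε₁)) ^ 2)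
          (solAt (𝒢 V) 0 (W𝒱 V) ε₄ (0 : 𝒵) (H₁ V (Φ V (cplx y))) + H₁ V (Φ V (cplx y)))))
        (fun y => (∑ i ∈ I, Ef V i (landauExp (Cf V) (ιs V) (Hop V)
          (4 * C₂ * (ε₄ + B₀ * (2 * dL * C₁ * ε₁)) ^ 2)
          (solAt (𝒢 V) 0 (W𝒱 V) ε₄ (0 : 𝒵) (H₁ V (Φ V (cplx y))) + H₁ V (Φ V (cplx y))))).re) x)
    (hudict : ∀ V, ∀ x ∈ cube m₀ S,
      u (fixTo T U₀ (updateFinset V Λ (expFibreChart Λ (c V) e x))) =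
        classifier hPu (fun p => holOf (plaqReadOut ℓ p) (fun y => landauExp (Cf V) (ιs V) (Hop V)
          (4 * C₂ * (ε₄ + B₀ * (2 * dL * C₁ * ε₁)) ^ 2)
          (solAt (𝒢 V) 0 (W𝒱 V) ε₄ (0 : 𝒵) (H₁ V (Φ V (cplx y))) + H₁ V (Φ V (cplx y))))) x)
    -- co-tests: supported in the window, centre-monotone, AT MOST ONE; the window inside the chart ball
    (hJW : ∀ V x, Jco V x ≠ 0 → x ∈ W V)
    (hJ : ∀ V x, ∀ a : ℝ, 0 ≤ a → Jco V x ≤ Jco V (Real.exp (-a) • x))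
    (hJ1 : ∀ V x, Jco V x ≤ 1)
    (hWS : ∀ V, W V ⊆ closedBall (0 : Fin m₀ → ℝ) S)
    -- numbers + the weight-side smallness `4κz̄ ≤ 1` + SM-L2 (SM) with `H = e^{4κz̄} − 1` in the currency `Rad = r_Φ / S`
    (hθ : 0 < θ) (hδ0 : 0 ≤ δ) (hδ1 : δ < 1) (hρ0 : 0 ≤ ρ) (hρ : ρ ≤ (1 - δ) / 2) (hβ : 0 ≤ β)
    (hsw1 : 4 * (κ * ((ε₄ + B₀ * (2 * dL * C₁ * ε₁)) +
      B₀ * (4 * C₂ * (ε₄ + B₀ * (2 * dL * C₁ * ε₁)) ^ 2))) ≤ 1)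
    (hSM : 36 * (Real.exp (4 * (κ * ((ε₄ + B₀ * (2 * dL * C₁ * ε₁)) +
      B₀ * (4 * C₂ * (ε₄ + B₀ * (2 * dL * C₁ * ε₁)) ^ 2)))) - 1) * 1 ^ 2 / (rΦ / S - 1) ^ 2 ≤ δ * θ) :
    SlotAntiConcentration ((fieldMeasure P j SU2).withDensity F) u θ ρ
      (2 * ((m₀ : ℝ) + (β * ∑ _p ∈ Pw,
        (4 * (3 * (κ * ((ε₄ + B₀ * (2 * dL * C₁ * ε₁)) +
          B₀ * (4 * C₂ * (ε₄ + B₀ * (2 * dL * C₁ * ε₁)) ^ 2))) / (rΦ / S - 1))) *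
          (0 + 4 * (4 * (κ * ((ε₄ + B₀ * (2 * dL * C₁ * ε₁)) +
            B₀ * (4 * C₂ * (ε₄ + B₀ * (2 * dL * C₁ * ε₁)) ^ 2))))) +
        3 * Hbar / (rΦ / S - 1))) / (1 - δ)) := by
  have h := slotAC_realized_su2_landauChart_print hT U₀ Λ e hS hSπ c hF hFi hFsupp hu hui hPu Pw W Jco 𝒢 W𝒱 h𝒢
    hW hB₀ hC₄ hε₄ hdL hC₁ hε₁ hB₃ h1 h2 h3 H₁ hH₁ Φ hΦd hΦ0 hΦ hSr Cf hC₂ hCq hCd ιs hι Hop hH h18 hcoup h3R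
    (fun p => plaqReadOut ℓ p) hκ (norm_plaqReadOut_le hℓ Pu) (length_plaqReadOut_le Pu ℓ)
    (fun p => plaqReadOut ℓ p) hκ (norm_plaqReadOut_le hℓ Pw) (length_plaqReadOut_le Pw ℓ)
    I Ef hEd hEb hsum hcoupE (signedReadOuts ℓ) (plaqReadOut_mem_signedReadOuts ℓ Pw) 𝓡𝒵 𝓡𝒴' 𝓡𝒳 h𝓡𝒳 𝓡ℬ
    h𝒢r hWr hιr hHr hCr hH₁r hΦr hRdict hudict hJW hJ hJ1 hWS hθ hδ0 hδ1 hρ0 hρ hβ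
    (by simpa only [Nat.cast_ofNat] using hsw1) (by simpa only [Nat.cast_ofNat] using hSM)
  simpa only [Nat.cast_ofNat] using h

end EndBondReadOuts

end Summit.QuantumFields.BalabanUV.T4Continuum.ShellMeasureBlockWiringReadOuts

end
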